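import Literature.NumberTheory.EllipticCurves.RingClassFieldSplitting
import Literature.NumberTheory.GaloisRepresentations.SplitPrimesAbsFrobenius
import HarnessLib

/-!
# Frobenius elements of `Γ_K` above `λ = (ℓ)` act trivially on the ring class field `K[n]`, `ℓ ∤ n`

Topic `Literature/NumberTheory/EllipticCurves` (vocabulary of `HeegnerPointsOfConductor.lean`: the
ring class field `ringClassField K ι n = K[n] = K(j(𝒪_n)) ⊆ ℂ` of conductor `n` of the imaginary
quadratic field `K`, Kolyvagin–Heegner data `KolyvaginHeegnerData` with its embedding
`emb : K[n] → K̄` and `toGeomPoints : E(K[n]) → E(K̄)`; of `IntegralGaloisAction.lean`: primes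
`𝔔 ∈ v.primesAbove` of `\bar ℤ_K` and arithmetic Frobenius elements `Φ ∈ Γ_K = absoluteGaloisGroup K`
(`IsArithFrobAt (𝓞 K) Φ 𝔔`); of `HeegnerPointsKolyvaginEulerSystem.lean`: Gross's Kolyvagin primes
`IsKolyvaginPrime N W K p ℓ` with their place `λ = (ℓ)`).  Theorem-only file (no definition, no named
fact, D-0026).

This is the `Γ_K`-form of *"the prime `λ` is principal and prime to `n`, so splits completely in
`K_n/K` by class field theory"* (Gross 1991, §3, p. 240 l. 1 of the reprint = proof of Prop. 3.7;
McCallum 1991, §4, p. 304: *"`λ` splits completely in `K_m`"*), in the currency in which the tree's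
Kolyvagin-system files consume it: **every arithmetic Frobenius `Φ ∈ Γ_K` at a prime of `\bar ℤ_K`
above `λ = (ℓ)`, `ℓ ∤ n` a Kolyvagin prime (more generally `v = (ℓ)` with `ℓ ∈ ℕ` prime to `n`),
fixes the embedded field `emb(K[n]) ⊆ K̄` pointwise, hence fixes the image in `E(K̄)` of every
`K[n]`-rational point.**

* `smul_algHom_ringClassField_eq_self_of_span_natCast` — `Φ • e x = e x` for every `K`-embedding
  `e : K[n] →ₐ[K] K̄`, `v = (ℓ)`, `ℓ` coprime to `n ≠ 0`, `𝔔 ∣ v`, `Φ` a Frobenius at `𝔔`;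
* `IsKolyvaginPrime.smul_algHom_ringClassField_eq_self` — the same at `λ = h.place` for a Kolyvagin
  prime `ℓ ∤ n`;
* `KolyvaginHeegnerData.smul_emb_eq_self_of_isKolyvaginPrime`,
  `KolyvaginHeegnerData.smul_toGeomPoints_eq_self_of_isKolyvaginPrime` (and the variant `_of_mem`
  phrased with `(ℓ : 𝓞 K) ∈ v.asIdeal`, `𝔔 ∈ v.primesAbove`) — for Kolyvagin–Heegner data `d` at
  level `n`: `Φ • d.emb x = d.emb x` and **`Φ • d.toGeomPoints P = d.toGeomPoints P`** for every
  `P ∈ E(K[n])`.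

Proof: `λ` splits completely in `K[n]` (`IsKolyvaginPrime.place_mem_splitPrimes_ringClassField`,
file `RingClassFieldSplitting`, from PROVED class field theory + Deuring–Bauer, no main theorem of
complex multiplication), and an arithmetic Frobenius above a completely split prime fixes the
(embedded) field pointwise (`smul_algHom_eq_self_of_mem_splitPrimes`, file
`GaloisRepresentations/SplitPrimesAbsFrobenius`); on points `Γ_K` acts coordinatewise.  As in
`RingClassFieldSplitting`, `K : Type` (universe `0`) because the class fields of characters are.

## References

* B. H. Gross, *Kolyvagin's work on modular elliptic curves*, in *L-functions and Arithmetic*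
  (Durham 1989), LMS Lecture Notes 153 (1991), §3 (Prop. 3.7 and its proof). [GrossLMS1991]
* W. G. McCallum, *Kolyvagin's work on Shafarevich–Tate groups*, in *L-functions and Arithmetic*,
  LMS Lecture Notes 153 (1991), §4 (Prop. 4.4, "`λ` splits completely in `K_m`"). [McCallumLMS1991]
* D. A. Marcus, *Number Fields* (2018), Ch. 4 (Frobenius and complete splitting). [Marcus2018]
-/

noncomputable section

open scoped Classical NumberField Pointwise
open NumberField IsDedekindDomain Field WeierstrassCurve

namespace Literature.NumberTheory.EllipticCurves

open Literature.NumberTheory.GaloisRepresentations Literature.NumberTheory.EllipticCurves.ModularForms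

variable {K : Type} [Field K] [NumberField K]

/-! ### Field level: Frobenius above `(ℓ)`, `ℓ` prime to `n`, fixes every embedded copy of `K[n]` -/

/-- **Frobenius elements above `v = (ℓ)`, `ℓ ∈ ℕ` prime to `n`, fix `K[n] ⊆ K̄` pointwise.**  For `K`
imaginary quadratic, `n ≠ 0`, a prime `v` of `K` with `v = ℓ𝓞_K` (`ℓ ∈ ℕ` coprime to `n`), a prime
`𝔔` of `\bar ℤ_K` above `v`, an arithmetic Frobenius `Φ ∈ Γ_K` at `𝔔` and any `K`-embedding
`e : K[n] → K̄`: `Φ (e x) = e x` for all `x ∈ K[n]` (`v` splits completely in `K[n]`, and Frobenius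
elements above completely split primes fix the field).
[cite: GrossLMS1991, §3 (proof of Prop. 3.7)] [cite: Marcus2018, Ch. 4, remark after Thm. 32] -/
theorem smul_algHom_ringClassField_eq_self_of_span_natCast (hK : IsImaginaryQuadratic K)
    (ι : K →+* ℂ) {n : ℕ} (hn : n ≠ 0) [IsGalois K (ringClassField K ι n)]
    (e : ringClassField K ι n →ₐ[K] AlgebraicClosure K) {v : HeightOneSpectrum (𝓞 K)} {ℓ : ℕ}
    (hvℓ : v.asIdeal = Ideal.span {((ℓ : ℕ) : 𝓞 K)}) (hℓ : Nat.Coprime ℓ n)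
    {𝔔 : Ideal (absIntegers (𝓞 K) K)} (h𝔔 : 𝔔 ∈ v.primesAbove) {Φ : absoluteGaloisGroup K}
    (hΦ : IsArithFrobAt (𝓞 K) Φ 𝔔) (x : ringClassField K ι n) : Φ • e x = e x := by
  haveI : FiniteDimensional K (ringClassField K ι n) :=
    (finiteDimensional_and_isGalois_ringClassField hK ι hn).1
  haveI : NumberField (ringClassField K ι n) := NumberField.of_module_finite K _
  exact smul_algHom_eq_self_of_mem_splitPrimes e
    (mem_splitPrimes_ringClassField_of_span_natCast hK ι hn hvℓ hℓ) h𝔔 hΦ x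

/-- **Ring-homomorphism form**: the same for an embedding given as a ring homomorphism
`emb : K[n] → K̄` that is the identity on `K` (the currency of `KolyvaginHeegnerData.emb`).
[cite: GrossLMS1991, §3 (proof of Prop. 3.7)] [cite: Marcus2018, Ch. 4, remark after Thm. 32] -/
theorem smul_ringHom_ringClassField_eq_self_of_span_natCast (hK : IsImaginaryQuadratic K)
    (ι : K →+* ℂ) {n : ℕ} (hn : n ≠ 0) [IsGalois K (ringClassField K ι n)]
    (emb : ringClassField K ι n →+* AlgebraicClosure K)
    (hemb : ∀ k : K, emb (algebraMap K (ringClassField K ι n) k) = algebraMap K (AlgebraicClosure K) k)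
    {v : HeightOneSpectrum (𝓞 K)} {ℓ : ℕ} (hvℓ : v.asIdeal = Ideal.span {((ℓ : ℕ) : 𝓞 K)})
    (hℓ : Nat.Coprime ℓ n) {𝔔 : Ideal (absIntegers (𝓞 K) K)} (h𝔔 : 𝔔 ∈ v.primesAbove)
    {Φ : absoluteGaloisGroup K} (hΦ : IsArithFrobAt (𝓞 K) Φ 𝔔) (x : ringClassField K ι n) :
    Φ • emb x = emb x :=
  smul_algHom_ringClassField_eq_self_of_span_natCast hK ι hn
    ({ emb with commutes' := hemb } : ringClassField K ι n →ₐ[K] AlgebraicClosure K) hvℓ hℓ h𝔔 hΦ x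

/-- **Gross 1991, §3 / McCallum 1991, §4 in `Γ_K`-form: for a Kolyvagin prime `ℓ ∤ n`, every
arithmetic Frobenius `Φ ∈ Γ_K` at a prime of `\bar ℤ_K` above `λ = (ℓ)` fixes `K[n] ⊆ K̄` pointwise**
(any `K`-embedding `e`).  [cite: GrossLMS1991, §3 (proof of Prop. 3.7)]
[cite: McCallumLMS1991, §4 (Prop. 4.4, "λ splits completely in K_m")] -/
theorem IsKolyvaginPrime.smul_algHom_ringClassField_eq_self {N : ℕ} {W : WeierstrassCurve ℚ}
    {p ℓ : ℕ} (h : IsKolyvaginPrime N W K p ℓ) (hK : IsImaginaryQuadratic K) (ι : K →+* ℂ) {n : ℕ}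
    (hn : n ≠ 0) [IsGalois K (ringClassField K ι n)] (hℓn : ¬ ℓ ∣ n)
    (e : ringClassField K ι n →ₐ[K] AlgebraicClosure K) {𝔔 : Ideal (absIntegers (𝓞 K) K)}
    (h𝔔 : 𝔔 ∈ h.place.primesAbove) {Φ : absoluteGaloisGroup K} (hΦ : IsArithFrobAt (𝓞 K) Φ 𝔔)
    (x : ringClassField K ι n) : Φ • e x = e x :=
  smul_algHom_ringClassField_eq_self_of_span_natCast hK ι hn e rfl
    ((Nat.Prime.coprime_iff_not_dvd h.prime).mpr hℓn) h𝔔 hΦ x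

/-! ### Kolyvagin–Heegner data: Frobenius above `λ` fixes `E(K[n]) ⊆ E(K̄)` -/

namespace KolyvaginHeegnerData

variable {N : ℕ} [NeZero N] {W : WeierstrassCurve ℚ} {Dt : ModularParametrizationData W N} {β : ℤ}
  {ι : K →+* ℂ} {n : ℕ} (d : KolyvaginHeegnerData Dt β ι n)

/-- For Kolyvagin–Heegner data `d` at level `n ≠ 0` and a Kolyvagin prime `ℓ ∤ n`: every arithmetic
Frobenius `Φ ∈ Γ_K` at a prime of `\bar ℤ_K` above `λ = (ℓ)` fixes `d.emb (K[n])` pointwise.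
[cite: GrossLMS1991, §3 (proof of Prop. 3.7)] [cite: McCallumLMS1991, §4 (Prop. 4.4)] -/
theorem smul_emb_eq_self_of_isKolyvaginPrime (hK : IsImaginaryQuadratic K) (hn : n ≠ 0)
    {N' p ℓ : ℕ} (h : IsKolyvaginPrime N' W K p ℓ) (hℓn : ¬ ℓ ∣ n)
    {𝔔 : Ideal (absIntegers (𝓞 K) K)} (h𝔔 : 𝔔 ∈ h.place.primesAbove) {Φ : absoluteGaloisGroup K}
    (hΦ : IsArithFrobAt (𝓞 K) Φ 𝔔) (x : ringClassField K ι n) : Φ • d.emb x = d.emb x := by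
  haveI : IsGalois K (ringClassField K ι n) := (finiteDimensional_and_isGalois_ringClassField hK ι hn).2
  exact smul_ringHom_ringClassField_eq_self_of_span_natCast hK ι hn d.emb d.emb_apply rfl
    ((Nat.Prime.coprime_iff_not_dvd h.prime).mpr hℓn) h𝔔 hΦ x

/-- **`Frob` above `λ` fixes the `K[n]`-rational points** (Gross 1991, proof of Prop. 3.7: `P_n`,
`y_n ∈ E(K_n)` are fixed by the decomposition groups above `λ`, which are trivial in
`Gal(K_n/K)`): for Kolyvagin–Heegner data `d` at level `n ≠ 0`, a Kolyvagin prime `ℓ ∤ n`, a prime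
`𝔔` of `\bar ℤ_K` above `λ = (ℓ)` and an arithmetic Frobenius `Φ ∈ Γ_K` at `𝔔`,
`Φ • d.toGeomPoints P = d.toGeomPoints P` for every `P ∈ E(K[n])` (`Γ_K` acts on `E(K̄)`
coordinatewise and fixes `d.emb (K[n])`).
[cite: GrossLMS1991, §3 (proof of Prop. 3.7)] [cite: McCallumLMS1991, §4 (Prop. 4.4)] -/
theorem smul_toGeomPoints_eq_self_of_isKolyvaginPrime (hK : IsImaginaryQuadratic K) (hn : n ≠ 0)
    {N' p ℓ : ℕ} (h : IsKolyvaginPrime N' W K p ℓ) (hℓn : ¬ ℓ ∣ n)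
    {𝔔 : Ideal (absIntegers (𝓞 K) K)} (h𝔔 : 𝔔 ∈ h.place.primesAbove) {Φ : absoluteGaloisGroup K}
    (hΦ : IsArithFrobAt (𝓞 K) Φ 𝔔) (P : (W.baseChange (ringClassField K ι n)).toAffine.Point) :
    Φ • d.toGeomPoints P = d.toGeomPoints P := by
  have hfix : ∀ x : ringClassField K ι n, Φ • d.emb x = d.emb x :=
    fun x => d.smul_emb_eq_self_of_isKolyvaginPrime hK hn h hℓn h𝔔 hΦ x
  rcases P with _ | ⟨x, y, hxy⟩
  · show Φ • d.toGeomPoints 0 = d.toGeomPoints 0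
    rw [map_zero, smul_zero]
  · have h1 : d.toGeomPoints (.some x y hxy) =
        Affine.Point.map (W' := W) d.emb.toRatAlgHom (.some x y hxy) := rfl
    rw [h1, Affine.Point.map_some]
    -- the image point, as a point of `(W⁄K)⁄K̄`, on which `Γ_K` acts coordinatewise
    have hns : ((W.baseChange K).baseChange (AlgebraicClosure K)).toAffine.Nonsingular
        (d.emb x) (d.emb y) :=
      (Affine.baseChange_nonsingular W d.emb.toRatAlgHom.injective x y).mpr hxy
    change Affine.Point.map (W' := W.baseChange K)
        ((show AlgebraicClosure K ≃ₐ[K] AlgebraicClosure K from Φ) :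
          AlgebraicClosure K →ₐ[K] AlgebraicClosure K)
        (Affine.Point.some (d.emb x) (d.emb y) hns) = Affine.Point.some (d.emb x) (d.emb y) hns
    rw [Affine.Point.map_some]
    simp only [Affine.Point.some.injEq, AlgEquiv.coe_toAlgHom]
    exact ⟨hfix x, hfix y⟩

/-- The same with the place as a variable: for `v ∋ ℓ` (necessarily `v = λ`), `𝔔 ∈ v.primesAbove`
and `Φ` an arithmetic Frobenius at `𝔔`, `Φ • d.toGeomPoints P = d.toGeomPoints P` — the shape of the
hypothesis `hsplit` of the tree's level-by-level Kolyvagin bookkeeping.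
[cite: GrossLMS1991, §3 (proof of Prop. 3.7)] [cite: McCallumLMS1991, §4 (Prop. 4.4)] -/
theorem smul_toGeomPoints_eq_self_of_isKolyvaginPrime_of_mem (hK : IsImaginaryQuadratic K)
    (hn : n ≠ 0) {N' p ℓ : ℕ} (h : IsKolyvaginPrime N' W K p ℓ) (hℓn : ¬ ℓ ∣ n)
    {v : HeightOneSpectrum (𝓞 K)} (hv : (ℓ : 𝓞 K) ∈ v.asIdeal) {𝔔 : Ideal (absIntegers (𝓞 K) K)}
    (h𝔔 : 𝔔 ∈ v.primesAbove) {Φ : absoluteGaloisGroup K} (hΦ : IsArithFrobAt (𝓞 K) Φ 𝔔)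
    (P : (W.baseChange (ringClassField K ι n)).toAffine.Point) :
    Φ • d.toGeomPoints P = d.toGeomPoints P := by
  have hvl : v = h.place := h.mem_iff.mp hv
  subst hvl
  exact d.smul_toGeomPoints_eq_self_of_isKolyvaginPrime hK hn h hℓn h𝔔 hΦ P

end KolyvaginHeegnerData

end Literature.NumberTheory.EllipticCurves

end
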